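import Literature.Topology.FourManifolds.HandleRealise
import Literature.Topology.FourManifolds.SPC4HandlesLemma2FromH1
import Literature.Topology.FourManifolds.LaudenbachPoenaruPositiveGenus
import HarnessLib

/-!
# Discharge of REALISE: Laudenbach–Poénaru's `H₁, H₂, H₃` on a model `1`-handlebody

Topic `Literature/Topology/FourManifolds`; sibling of `SPC4HandlesNielsenReduction.lean`, where
the named fact `Literature.Topology.FourManifolds.exists_oneHandlebody_realise_laudenbachPoenaruGenerators`
(**REALISE**: for every `p`, on some compact connected orientable `4`-dimensional `1`-handlebody
`V₀` with `p` `1`-handles, the Laudenbach–Poénaru automorphisms `Φ₁` (transpositions of basis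
elements), `Φ₂` (`x₀ ↦ x₀⁻¹`), `Φ₃` (`x₀ ↦ x₀ x₁`) of `π₁(∂V₀, z₀) ≅ F_p` are induced by based
self-diffeomorphisms of the boundary that extend over `V₀`; Laudenbach–Poénaru, Bull. SMF 100
(1972), §2, proof of Lemma 2, pp. 339–340: "three diffeomorphisms `Hᵢ : (Y_p, x₀) → (Y_p, x₀)`
such that `(Hᵢ)_# = Φᵢ`") is stated.  Everything here is **proved**; no definition and no named
fact is introduced.

The discharge is a composition of two theorems of the tree: Laudenbach–Poénaru's Lemma 2 on
every decomposed `1`-handlebody, **h₁** = `laudenbachPoenaru_exists_diffeoExtends_mapOfEq_eq`,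
is discharged in `HandleRealise.lean` (`laudenbachPoenaru_exists_diffeoExtends_mapOfEq_eq_holds`:
handle slides, flips and point pushes realise Nielsen's generators of `Aut F_k` on every
`1`-handlebody), and **h₁ → REALISE** is
`exists_oneHandlebody_realise_laudenbachPoenaruGenerators_of_forall`
(`SPC4HandlesLemma2FromH1.lean`: specialise h₁ to one model per `p`, through LEMMA2ᴹ).  The
file of the fact cannot host the discharge (`HandleRealise.lean` imports it), hence this sibling.

Consequence recorded here: of the three inputs of
`exists_diffeomorph_comp_incl_eq_holds_of` (`LaudenbachPoenaruPositiveGenus.lean`) — REALISE,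
Cerf's `Γ₄ = 0` in extension form (`cerf_diffeomorph_sphere_three_extends_ball`) and Thm. A on
the model in positive genus (`laudenbachPoenaru_thmA_model_succ`) — only the last two remain:
`exists_diffeomorph_comp_incl_eq_of_cerf_of_succ`.

## References

* F. Laudenbach, V. Poénaru, *A note on 4-dimensional handlebodies*, Bull. Soc. Math. France
  100 (1972), 337–344: §2, Lemma 2 and its proof (pp. 339–340), proof of Thm. A (pp. 341–342).
  Held: `lit read doi-10-24033-bsmf-1741`. [LaudenbachPoenaruBSMF1972]
* J. Cerf, *Sur les difféomorphismes de la sphère de dimension trois (Γ₄ = 0)*, LNM 53 (1968),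
  Ch. I §1, Théorème 1 with Corollaire 1. [CerfDiffeoSphere1968]
-/

noncomputable section

namespace Literature.Topology.FourManifolds

universe u

/-- **REALISE, discharged** (`exists_oneHandlebody_realise_laudenbachPoenaruGenerators`): for
every `p` there is a compact connected orientable `4`-dimensional `1`-handlebody `V₀` with `p`
`1`-handles, a boundary datum `b₀`, a base point `z₀` and an isomorphism
`e : π₁(b₀.carrier, z₀) ≅ F_p` such that each of Laudenbach–Poénaru's generators `Φ₁, Φ₂, Φ₃`
(`laudenbachPoenaruGenerators p`), read through `e`, is induced by a self-diffeomorphism of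
`b₀.carrier` fixing `z₀` that extends over `V₀` — Laudenbach–Poénaru's "three diffeomorphisms
`Hᵢ : (Y_p, x₀) → (Y_p, x₀)` (`i = 1, 2, 3`) such that `(Hᵢ)_# = Φᵢ`" (proof of Lemma 2,
p. 340).  Proof: Lemma 2 on every decomposed `1`-handlebody
(`laudenbachPoenaru_exists_diffeoExtends_mapOfEq_eq_holds`, `HandleRealise.lean`) specialised to
a model (`exists_oneHandlebody_realise_laudenbachPoenaruGenerators_of_forall`,
`SPC4HandlesLemma2FromH1.lean`).
[cite: LaudenbachPoenaruBSMF1972, §2, proof of Lemma 2 (pp. 339–340)] -/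
theorem exists_oneHandlebody_realise_laudenbachPoenaruGenerators_holds :
    exists_oneHandlebody_realise_laudenbachPoenaruGenerators.{u} :=
  exists_oneHandlebody_realise_laudenbachPoenaruGenerators_of_forall
    laudenbachPoenaru_exists_diffeoExtends_mapOfEq_eq_holds

/-- **Laudenbach–Poénaru's extension theorem from its two remaining inputs**: with REALISE
discharged (`exists_oneHandlebody_realise_laudenbachPoenaruGenerators_holds`), the named fact
`exists_diffeomorph_comp_incl_eq` (every diffeomorphism between the boundaries of two compact
connected orientable `4`-dimensional `1`-handlebodies with the same number of `1`-handles
extends) follows, in every universe, from Cerf's `Γ₄ = 0` in extension form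
(`cerf_diffeomorph_sphere_three_extends_ball`) and Thm. A on the model in positive genus
(`laudenbachPoenaru_thmA_model_succ`) alone — `exists_diffeomorph_comp_incl_eq_holds_of`
(`LaudenbachPoenaruPositiveGenus.lean`) with its first argument supplied.
[cite: LaudenbachPoenaruBSMF1972, §2, Lemma 2 and proof of Thm. A (pp. 339–342)]
[cite: CerfDiffeoSphere1968, Ch. I §1, Théorème 1 with Corollaire 1 (Γ₄ = 0)] -/
theorem exists_diffeomorph_comp_incl_eq_of_cerf_of_succ
    (hC : cerf_diffeomorph_sphere_three_extends_ball)
    (hA : laudenbachPoenaru_thmA_model_succ) :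
    exists_diffeomorph_comp_incl_eq.{u} :=
  exists_diffeomorph_comp_incl_eq_holds_of
    exists_oneHandlebody_realise_laudenbachPoenaruGenerators_holds hC hA

end Literature.Topology.FourManifolds

end
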